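import Literature.IUT.LogThetaLattice.BiCores
import HarnessLib

/-!
# [IUTchIII] Proposition 1.2 (viii), (ix): nonemptiness and orbit containment of the composite
# [poly-]isomorphisms of mono-analytic / coric holomorphic log-shells (proof-only companion to `BiCores`)

Mochizuki, *Inter-universal Teichmüller Theory III*, kurims manuscript (May 2020), §1, Prop 1.2
(viii) p.33, (ix) p.34 [claim: Mochizuki2012, status: disputed] (D-0012 claim key; record-only; this file
takes no side on anything and proves only elementary consequences of the INTERFACE `BiCoricData` of
`BiCores.lean`, abc-iut-L6-t3, p406839).

Discharge-wave companion (abc-iut cell, D-0067 cone of [IUTchIII] Cor 3.12, nodes `IUTchIII:Prop1.2(viii)`,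
`IUTchIII:Prop1.2(ix)`). `BiCores.lean` DEFINES the composite [poly-]isomorphisms of the two displays of
Prop 1.2 (viii) (`BiCoricData.monoHolAt`, with `†D^⊢` computed through `†F^{⊢×μ}`, and `monoHolAt'`, with
`†D^⊢ = D^⊢(D(†F))`) and the "natural isomorphisms `I_{*D^⊢} ⥲ I_{*D}`" of Prop 1.2 (ix) (`coricIsoAt`), and
PROVES `monoHolAt_nonempty` / `monoHolAt_subset_orbit`. This file adds the corresponding facts for the
primed composite and for the coric isomorphisms: each is a NONEMPTY poly-isomorphism (so the printed
"[poly-]isomorphism" is an actual collection of isomorphisms, not the empty one) and each lies inside the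
`Ism`-orbit-level composite built "solely from the `F^{⊢×μ}`-prime-strip" (Prop 1.2 (vi): "compatible with one
another"). Nothing here is new mathematics; no definition is introduced.
-/

namespace Literature.IUT.LogThetaLattice

open CategoryTheory
open Literature.IUT.HodgeTheaters

universe u

namespace BiCoricData

variable {S : StripFrame.{u}} (B : BiCoricData S)

/-- **IUTchIII:Prop1.2(viii)** (kurims p.33) the composite [poly-]isomorphism
`log(†D^⊢) ⥲ log(†F^{⊢×μ}) ⥲ log(†F)` with `†D^⊢ = D^⊢(D(†F))` (`monoHolAt'`) is a NONEMPTY collection of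
isomorphisms. [claim: Mochizuki2012, status: disputed] -/
theorem monoHolAt'_nonempty (X : S.F) : (B.monoHolAt' X).Nonempty := by
  obtain ⟨g, hg⟩ := B.monoHolAt_nonempty X
  exact ⟨_, _, rfl, g, hg, rfl⟩

/-- **IUTchIII:Prop1.2(viii)** (kurims p.33) membership in the primed composite: an isomorphism belongs to
`monoHolAt' X` iff it is the frame identification `I_{D^⊢(D(†F))} = I_{D^⊢(†F^{⊢×μ})}` followed by a member of
`monoHolAt X`. [claim: Mochizuki2012, status: disputed] -/
theorem mem_monoHolAt'_iff (X : S.F)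
    (e : B.monoShell.obj (S.DToDv.obj (S.toD.obj X)) ≅ B.holShell.obj X) :
    e ∈ B.monoHolAt' X ↔
      ∃ g ∈ B.monoHolAt X, (B.monoShell.mapIso (S.fxmDvIsoAt X)).symm ≪≫ g = e := by
  constructor
  · rintro ⟨a, ha, g, hg, rfl⟩
    rw [PolyIso.mem_single] at ha
    subst ha
    exact ⟨g, hg, rfl⟩
  · rintro ⟨g, hg, rfl⟩
    exact ⟨_, rfl, g, hg, rfl⟩

/-- **IUTchIII:Prop1.2(viii)** (kurims p.33) / Prop 1.2 (vi) "compatible with one another": the primed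
`†F`-level composite lies inside the `Ism`-orbit-level composite (the one "constructed solely from the
`F^{⊢×μ}`-prime-strip"), transported along the same frame identification. [claim: Mochizuki2012, status: disputed] -/
theorem monoHolAt'_subset_orbit (X : S.F) :
    B.monoHolAt' X ⊆
      (PolyIso.single (B.monoShell.mapIso (S.fxmDvIsoAt X)).symm).comp
        ((B.monoFxm (S.toFxm.obj X)).comp (B.fxmHol X)) := by
  rintro e ⟨a, ha, g, hg, rfl⟩
  exact ⟨a, ha, g, B.monoHolAt_subset_orbit X hg, rfl⟩

/-- **IUTchIII:Prop1.2(ix)** (kurims p.34) the "natural isomorphisms `I_{*D^⊢} ⥲ I_{*D}`" of the coric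
holomorphic log-shells (`coricIsoAt`, a [poly-]isomorphism: one isomorphism at `v ∈ V̲^{non}`, a `{±1}`-orbit at
`v ∈ V̲^{arc}` in print) form a NONEMPTY collection. [claim: Mochizuki2012, status: disputed] -/
theorem coricIsoAt_nonempty (D : S.D) : (B.coricIsoAt D).Nonempty := by
  obtain ⟨g, hg⟩ := B.monoHolAt'_nonempty (B.FofD.obj D)
  exact ⟨_, _, rfl, g, hg, rfl⟩

/-- **IUTchIII:Prop1.2(ix)** (kurims p.34) membership: an isomorphism belongs to `coricIsoAt D` iff it is the
identification `I_{*D^⊢} = I_{D^⊢(D(F(*D)))}` (from `D(F(*D)) = *D`, [IUTchII] Rmk 4.5.1 (i)) followed by a member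
of the Prop 1.2 (viii) composite for `†F = F(*D)`. [claim: Mochizuki2012, status: disputed] -/
theorem mem_coricIsoAt_iff (D : S.D)
    (e : B.monoShell.obj (S.DToDv.obj D) ≅ B.coricHolShell.obj D) :
    e ∈ B.coricIsoAt D ↔
      ∃ g ∈ B.monoHolAt' (B.FofD.obj D),
        (B.monoShell.mapIso (S.DToDv.mapIso (B.FofD_D.app D))).symm ≪≫ g = e := by
  constructor
  · rintro ⟨a, ha, g, hg, rfl⟩
    rw [PolyIso.mem_single] at ha
    subst ha
    exact ⟨g, hg, rfl⟩
  · rintro ⟨g, hg, rfl⟩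
    exact ⟨_, rfl, g, hg, rfl⟩

/-- **IUTchIII:Prop1.2(ix)** (kurims p.34) "a functorial algorithm in the `D`-prime-strip `*D`": the coric
holomorphic log-shell functor `*D ↦ I_{*D} := I_{F(*D)}` sends an isomorphism of `D`-prime-strips to the
isomorphism of log-shell data induced through `F(−)` (functoriality is definitional: `coricHolShell = FofD ⋙
holShell`). [claim: Mochizuki2012, status: disputed] -/
theorem coricHolShell_mapIso {D D' : S.D} (d : D ≅ D') :
    B.coricHolShell.mapIso d = B.holShell.mapIso (B.FofD.mapIso d) := rfl

end BiCoricData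

end Literature.IUT.LogThetaLattice
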